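import Literature.MathematicalPhysics.QuantumFieldTheory.Balaban1983to89.B5Hk163RateSum

/-!
# Bałaban 1984 (B5) (1.63) in position space: sup-norm and Hölder-modulus η-rates of the
# fixed-fibre kernels of `∂_ν h_{μλ}` (King 1986 §4 (4.24)/(4.26) transferred)

HONEST FRAMING (page 1). This module is a piece of the LINEAR THEORY of the spine estimate NE2
(η-rate) at rung (B)+1: FINITE TORUS, trivial background `U = 1`, general dimension `d ≥ 1`.
It converts the Fourier-side rates of `B5Hk163Rate` (per mode) and `B5Hk163RateSum` (weighted
alias sums) into POSITION-SPACE bounds by the only step that separates them — the trivial bound of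
a trigonometric polynomial by the `ℓ¹` norm of its coefficients and the phase modulus
`|e^{iq·x} − e^{iq·x′}| ≤ 2^{1−α}‖q‖^α|x−x′|^α`. It is NOT an infinite-volume statement, NOT a
mass-gap statement, NOT progress on any Clay problem, and it does NOT identify the trigonometric
kernels below with the operator kernels of Bałaban's `H_k` (see WHAT IS NOT CLAIMED).

## The objects

For a level `n` (fine lattice `(1/n)ℤ^d` over the unit lattice), a non-zero fibre momentum
`p′ ∈ [−π,π]^d` and directions `μ, λ, ν`, the fixed-fibre kernel is the trigonometric polynomial
`kerFib n μ λ ν p′ x = Σ_{k ∈ (Fin n)^d} ∂^{(n)}_ν(q̃_k) · h^{(n)}_{μλ}(k; p′) · e^{i q̃_k·x}`,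
`x ∈ ℝ^d`, where `q̃_k = symmAlias n k p′` is the centred representative of the alias class
`p′ + 2πk` (`|q̃_{k,ν}| ≤ πn`), `∂^{(n)} = B5Prop11Fiber.dSym n` and `h^{(n)} = B5Hk163Strip.h163 n`
is the cross-read (1.63) multiplier family of the b05 lineage.  (At lattice points
`x ∈ (1/n)ℤ^d` the value does not depend on the choice of representatives — a remark, neither
used nor formalised.)  The reader's kernel on
a unit torus with `M^d` sites is `M^{−d} Σ_{p′} e^{ip′·(x−y)} kerFib n μ λ ν p′ x` (fibre sum,
§6, with the `p′ = 0` fibre excluded throughout: every theorem carries `p′_{ν₀} ≠ 0`).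

## What is proved (all `[folklore]`; constants `C0maj, C1maj, aliasConst, T163` of the parents)

* §1 `norm_phase_sub_phase_le`: `|e^{iq·x} − e^{iq·x′}| ≤ 2^{1−α} ‖q‖_∞^α |x−x′|₁^α`, `0 ≤ α ≤ 1`.
* §3 uniform in the level: `norm_kerFib_le` (`|kerFib^{(n)}(x)| ≤ C₀π + C₁ aliasConst_d(0)`) and
  `kerFib_holder_le` (`|kerFib^{(n)}(x) − kerFib^{(n)}(x′)| ≤ 2^{1−α}|x−x′|₁^α (C₀π^{1+α}
  + C₁ aliasConst_d(α))`, `0 ≤ α < 1`).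
* §4 `kerFib_sub_eq`: the difference between the levels `RN` and `N` is
  `Σ_k (c^{(RN)}_{ιk} − c^{(N)}_k) e^{iq̃_k·x} + Σ_{k″ unpaired} c^{(RN)}_{k″} e^{iq̃_{k″}·x}` — the
  pairing `ι` of `B5Hk163Rate` §7 carries the SAME plane wave (`symmAlias_iota`).
* §5 THE RATES: `kerFib_rate` (`|kerFib^{(RN)}(x) − kerFib^{(N)}(x)| ≤ T163(d,0,γ) N^{−γ}`,
  `0 < γ < 1`), `kerFib_rate_holder` (`|Δ(x) − Δ(x′)| ≤ 2^{1−α}|x−x′|₁^α T163(d,α,γ) N^{−γ}`,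
  `0 ≤ α`, `0 < γ ≤ 1`, `α + γ < 1`) and its difference-quotient form
  `kerFib_rate_holder_quotient`; all uniform in `x, x′ ∈ ℝ^d`, the fibre and `R ≥ 1`.
* §6 fibre sums with coefficients of modulus `≤ 1`: `kerFib_rate_fibreSum`,
  `kerFib_rate_holder_fibreSum` (`≤ |S| ·` the fixed-fibre bound).

## Sources (locations only; every declaration is `[folklore]`, no constant is attributed to print)

[cite: King1986, p.672 (4.19)] «Using the representation (4.2), we shall now establish the last
bound in (3.71). The rest of Proposition 3.8 is simpler. We have the identity
(∂_α(x′, y′)∂^{η′}_μ a_{k+n}G^{η′}_{k+n}Q^*_{k+n})(z) = (2π)^{−d} ∫dp′ Σ_l Σ_m e^{i(p′+l+m)(x′−z)}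
|x′−y′|^{−α}{1 − exp[i(p′+l+m)(y′−x′)]} · (η)^{−1}{exp[iη′(p′+l+m)_μ] − 1}
{Δ^{(k+n)}(p′)u^{η′}_{k+n}(p′+l+m)Δ^{η′}(p′+l+m)^{−1}}, (4.19) where l ∈ 2πZ^d is the same as in
(4.2). Also m ∈ 2πL^kZ^d and |m_μ| ≦ πL^k(L^n − 1) for L odd, while m ∈ 2π(L^k+1)Z^d and
|m_μ| ≦ π(L^k+1)(L^n−1) for L even. The corresponding expression for G^η_k is obtained from (4.19)
by replacing x′, y′, η′ by x, y, η and (k+n) by (k), and taking m = 0.» — DICTIONARY (analogue,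
not instance): King's scalar multiplier `Δ^{(k)}(p′) u(p′+l) Δ^η(p′+l)^{−1}` of `a_kG_kQ_k^*` ↦
the vector family `h^{(n)}_{μλ}(l; p′)` (B5 (1.63), `B5Hk163Strip.h163`); `(η)^{−1}{exp[iη(p′+l)_μ]
− 1}` ↦ `dSym`; `e^{i(p′+l)(x−z)}` ↦ `phase (symmAlias n k p′) x` (our `x` is King's `x − z`,
the position relative to the unit-lattice point `z`); `Σ_l` at spacing `η` ↦ `Σ_{k ∈ (Fin N)^d}`,
`Σ_{l,m}` at `η′` ↦ `Σ_{k″ ∈ (Fin RN)^d}` split by the pairing `ι` into `m = 0` / `m ≠ 0`;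
`|x−y|^{−α}{f(x) − f(y)}` ↦ the difference quotient of §5; `(2π)^{−d}∫dp′` ↦ the fibre sum of §6.

[cite: King1986, p.673 (4.24)] «First we have |exp[i(p′+l)x] − exp[i(p′+l)x′]|
≦ C|p′+l|^γ |x−x′|^γ ≦ CL^{−γk}|p′+l|^γ. (4.24) So keeping γ + α < 1, the error produced by the
above replacement is bounded by CL^{−γk}.» — here `norm_phase_sub_phase_le` (with `2^{1−γ}` for
`C`) and `kerFib_rate` / `kerFib_holder_le`.
[cite: King1986, p.673 (4.26)] «For the Hölder derivatives, suppose |x−y| ≦ L^{−k}. Then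
|x−y|^{−α}|1 − exp[i(p′+l)(y−x)]| ≦ C|p′+l|^{α+γ}|x−y|^γ ≦ CL^{−γk}|p′+l|^{α+γ}. (4.26)» — the
weight `|p′+l|^α` of the alias sums is exactly the price of the Hölder modulus; here
`kerFib_rate_holder(_quotient)` with the weight `‖q̃‖_∞^α` (reading (iii) of `B5Hk163RateSum`).
[cite: King1986, p.673 (4.27)–(4.28)] «Furthermore, when |x−y| > L^{−k}, we have
||x−y| − |x′−y′|| ≦ L^{−k}. (4.27) Therefore it follows easily that ||x−y|^{−α}{1 − exp[i(p′+l)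
(y−x)]} − |x′−y′|^{−α}{1 − exp[i(p′+l)(y′−x′)]}| ≦ CL^{−γk}|p′+l|^{α+γ}, (4.28) where we have
assumed α + γ < 1 and γ ≦ α.» — NOT formalised here (see (ii) below); quoted as the shape of the
remaining bookkeeping.  Pages read as images from
`HOME/b2b-balaban-template/king-renders/1986-cmp102-king-u1-higgs-I-p025-x2.png` (p.673) and
`…-p024-x2.png` (p.672); `≦` rendered `≤` in statements.
[cite: Balaban1984PropagatorsI, p.29, sentence after (1.63)] (the boundedness-in-`|l|` input,
quoted verbatim in `B5Hk163Rate`) enters only through the parents.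

## WHAT IS NOT CLAIMED

(i) `kerFib` is a trigonometric polynomial BUILT FROM the multiplier family `B5Hk163Strip.h163`;
its identification with the position-space kernel `(∂_ν H_k)(x, y)` of Bałaban's minimiser `H_k`
on the torus `T_η` (the operator-level statement of B5 (1.63), including `R ∂^* G Q^* = 0`) is the
open kernel↔multiplier dictionary item of the b05 lineage (GAPS G-b05g10-4) and is not touched.
(ii) King's packaging (4.27)/(4.28) — `|x−y|^{−α}` prefactors, the replacement of `x, y` by the
nearest points `x′, y′` of the coarser lattice, the case split at `|x−y| = L^{−k}` — is routine
bookkeeping on top of `kerFib_rate_holder` + `kerFib_holder_le` + `norm_kerFib_le` and is left to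
the assembler; (4.19) itself (the kernel of `∂_α ∂^η_μ a_k G_k Q_k^*`) is King's SCALAR operator,
whose vector analogue here is only the symbol-level family above.
(iii) The zero fibre `p′ = 0` (zero mode of the unit-lattice field) is excluded by hypothesis; its
separate treatment («Ã_μ(0) = a⁻¹J̃_μ(0)»-type special values in B5) is not formalised.
(iv) The normalisation `M^{−d}` and the phases `e^{−ip′·y}` of the unit-torus kernel are the
reader's: §6 bounds the fibre sum for ANY coefficients of modulus `≤ 1` by `|S|` times the
fixed-fibre bound, which after division by `M^d ≥ |S|` is the sup bound.
(v) No infinite-volume limit, no `U ≠ 1` background, no mass gap; constants explode as `α+γ → 1`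
(through `aliasConst`), exactly as in the parents.

VERSION v1 (2026-08-19, seat b2b-balaban-t4-ne2-p1-g3): new module; parents `B5Hk163Rate` v1.1
(da6d514bc683), `B5Hk163RateSum` v1 (302383c5268f).
-/

namespace Literature.MathematicalPhysics.QuantumFieldTheory.Balaban1983to89.B5Hk163RatePosition

open scoped BigOperators ComplexConjugate
open Finset Complex
open Literature.MathematicalPhysics.QuantumFieldTheory.Balaban1983to89.B4Strip
open Literature.MathematicalPhysics.QuantumFieldTheory.Balaban1983to89.B5Prop11Leaves
open Literature.MathematicalPhysics.QuantumFieldTheory.Balaban1983to89.B5Prop11Fiber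
open Literature.MathematicalPhysics.QuantumFieldTheory.Balaban1983to89.B5Hk163Rate
open Literature.MathematicalPhysics.QuantumFieldTheory.Balaban1983to89.B5Hk163RateSum
open Literature.MathematicalPhysics.QuantumFieldTheory.King1986

noncomputable section

variable {d : ℕ}

/-! ## 1. Phases `e^{i q·x}` and their Hölder modulus (King (4.24)/(4.26) mechanism) -/

/-- `ℓ¹` length `|v|₁ = Σ_j |v_j|` of a position-space displacement. [folklore] -/
def l1 (v : Fin d → ℝ) : ℝ := ∑ j, |v j|

/-- `0 ≤ |v|₁`. [folklore] -/
theorem l1_nonneg (v : Fin d → ℝ) : 0 ≤ l1 v := Finset.sum_nonneg fun _ _ => abs_nonneg _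

/-- the pairing `q·x = Σ_j q_j x_j`. [folklore] -/
def dotR (q x : Fin d → ℝ) : ℝ := ∑ j, q j * x j

/-- `q·x − q·x′ = q·(x − x′)`. [folklore] -/
theorem dotR_sub (q x x' : Fin d → ℝ) : dotR q x - dotR q x' = dotR q (x - x') := by
  unfold dotR
  rw [← Finset.sum_sub_distrib]
  exact Finset.sum_congr rfl fun j _ => by rw [Pi.sub_apply, mul_sub]

/-- `|q·v| ≤ ‖q‖_∞ |v|₁`. [folklore] -/
theorem abs_dotR_le (q v : Fin d → ℝ) : |dotR q v| ≤ ‖q‖ * l1 v := by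
  unfold dotR l1
  calc |∑ j, q j * v j| ≤ ∑ j, |q j * v j| := Finset.abs_sum_le_sum_abs _ _
    _ = ∑ j, |q j| * |v j| := Finset.sum_congr rfl fun j _ => abs_mul _ _
    _ ≤ ∑ j, ‖q‖ * |v j| :=
        Finset.sum_le_sum fun j _ => mul_le_mul_of_nonneg_right (abs_apply_le_norm q j) (abs_nonneg _)
    _ = ‖q‖ * ∑ j, |v j| := by rw [Finset.mul_sum]

/-- the plane wave `e^{i q·x}` of (fine) momentum `q` at the point `x ∈ ℝ^d`. [folklore] -/
def phase (q x : Fin d → ℝ) : ℂ := Complex.exp (((dotR q x : ℝ) : ℂ) * I)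

/-- `|e^{i q·x}| = 1`. [folklore] -/
theorem norm_phase (q x : Fin d → ℝ) : ‖phase q x‖ = 1 := Complex.norm_exp_ofReal_mul_I _

/-- THE PHASE MODULUS (the mechanism of King (4.24) p.673 «|exp[i(p′+l)x] − exp[i(p′+l)x′]|
≦ C|p′+l|^γ |x−x′|^γ» and of (4.26)): for `0 ≤ α ≤ 1`,
`|e^{iq·x} − e^{iq·x′}| ≤ 2^{1−α} ‖q‖_∞^α |x − x′|₁^α` (interpolating `≤ 2` and `≤ |q·(x−x′)|`).
[folklore] -/
theorem norm_phase_sub_phase_le {α : ℝ} (hα0 : 0 ≤ α) (hα1 : α ≤ 1) (q x x' : Fin d → ℝ) :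
    ‖phase q x - phase q x'‖ ≤ 2 ^ (1 - α) * (‖q‖ ^ α * l1 (x - x') ^ α) := by
  set u : ℝ := dotR q (x - x') with hu_def
  have hfac : phase q x - phase q x' = phase q x' * (Complex.exp (((u : ℝ) : ℂ) * I) - 1) := by
    unfold phase
    rw [mul_sub, mul_one, ← Complex.exp_add, hu_def, ← dotR_sub]
    congr 1
    push_cast
    ring
  have hsq : ‖Complex.exp (((u : ℝ) : ℂ) * I) - 1‖ ^ 2 ≤ |u| ^ 2 := by
    rw [B5Prop11Fiber.norm_exp_mul_I_sub_one_sq, sq_abs]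
    unfold S1r
    have := Real.one_sub_sq_div_two_le_cos (x := u)
    linarith
  have hau : ‖Complex.exp (((u : ℝ) : ℂ) * I) - 1‖ ≤ |u| := by
    nlinarith [norm_nonneg (Complex.exp (((u : ℝ) : ℂ) * I) - 1), abs_nonneg u]
  have ha2 : ‖Complex.exp (((u : ℝ) : ℂ) * I) - 1‖ ≤ 2 := by
    calc ‖Complex.exp (((u : ℝ) : ℂ) * I) - 1‖
        ≤ ‖Complex.exp (((u : ℝ) : ℂ) * I)‖ + ‖(1 : ℂ)‖ := norm_sub_le _ _
      _ = 2 := by rw [Complex.norm_exp_ofReal_mul_I]; norm_num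
  have hB : |u| ≤ ‖q‖ * l1 (x - x') := abs_dotR_le q (x - x')
  have hB0 : 0 ≤ ‖q‖ * l1 (x - x') := mul_nonneg (norm_nonneg _) (l1_nonneg _)
  have ha0 : 0 ≤ ‖Complex.exp (((u : ℝ) : ℂ) * I) - 1‖ := norm_nonneg _
  have key : ‖Complex.exp (((u : ℝ) : ℂ) * I) - 1‖ ≤ 2 ^ (1 - α) * (‖q‖ * l1 (x - x')) ^ α := by
    rcases ha0.eq_or_lt with h0 | hpos
    · rw [← h0]
      exact mul_nonneg (Real.rpow_nonneg (by norm_num) _) (Real.rpow_nonneg hB0 _)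
    · have h1 : ‖Complex.exp (((u : ℝ) : ℂ) * I) - 1‖
          = ‖Complex.exp (((u : ℝ) : ℂ) * I) - 1‖ ^ (1 - α)
            * ‖Complex.exp (((u : ℝ) : ℂ) * I) - 1‖ ^ α := by
        rw [← Real.rpow_add hpos]; norm_num
      rw [h1]
      exact mul_le_mul (Real.rpow_le_rpow ha0 ha2 (by linarith))
        (Real.rpow_le_rpow ha0 (hau.trans hB) hα0) (Real.rpow_nonneg ha0 _)
        (Real.rpow_nonneg (by norm_num) _)
  rw [hfac, norm_mul, norm_phase, one_mul, ← Real.mul_rpow (norm_nonneg _) (l1_nonneg _)]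
  exact key

/-! ## 2. The fixed-fibre trigonometric kernel of `∂_ν h_{μλ}` -/

/-- the Fourier coefficient `c^{(n)}_k = ∂^{(n)}_ν(q_k) · h^{(n)}_{μλ}(k; p′)` of the alias class `k`
at the fibre `p′` (level `n`, fine spacing `1/n`). [folklore] -/
def coef (n : ℕ) [NeZero n] (μ lam ν : Fin d) (p : Fin d → ℝ) (k : Fin d → Fin n) : ℂ :=
  dSym n k p ν * B5Hk163Strip.h163 n μ lam k (ofRealVec p)

/-- THE FIXED-FIBRE KERNEL: `x ↦ Σ_k c^{(n)}_k e^{i q̃_k·x}` (`q̃_k` = the centred representative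
`symmAlias n k p′` of the alias class), a trigonometric polynomial on `ℝ^d` (our `x` is King's
`x − z`, the position relative to the unit-lattice point). [folklore] -/
def kerFib (n : ℕ) [NeZero n] (μ lam ν : Fin d) (p x : Fin d → ℝ) : ℂ :=
  ∑ k : Fin d → Fin n, coef n μ lam ν p k * phase (symmAlias n k p) x

/-- `|c_k| = |h(k;p′)| · |∂_ν(q_k)|`. [folklore] -/
theorem norm_coef (n : ℕ) [NeZero n] (μ lam ν : Fin d) (p : Fin d → ℝ) (k : Fin d → Fin n) :
    ‖coef n μ lam ν p k‖ = ‖B5Hk163Strip.h163 n μ lam k (ofRealVec p)‖ * ‖dSym n k p ν‖ := by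
  unfold coef; rw [norm_mul, mul_comm]

/-- `|c_k| · ‖q̃_k‖^α = |h(k;p′)| · bwt_α(k)` (the weight of `B5Hk163Rate` §6). [folklore] -/
theorem norm_coef_mul_rpow (n : ℕ) [NeZero n] (μ lam ν : Fin d) (p : Fin d → ℝ)
    (k : Fin d → Fin n) (α : ℝ) :
    ‖coef n μ lam ν p k‖ * ‖symmAlias n k p‖ ^ α
      = ‖B5Hk163Strip.h163 n μ lam k (ofRealVec p)‖ * bwt n k p ν α := by
  rw [norm_coef]; unfold bwt; ring

/-! ## 3. Uniform bounds: sup norm and Hölder modulus of the kernel at one level -/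

/-- SUP BOUND of the fixed-fibre kernel, uniform in the level `n`, the fibre `p′ ≠ 0` and `x`:
`|ker^{(n)}(x)| ≤ Σ_k |∂_ν(q_k)| |h(k;p′)| ≤ C₀ π + C₁ · aliasConst_d(0)`. [folklore] -/
theorem norm_kerFib_le (hd : 0 < d) {n : ℕ} [NeZero n] (hn : 1 ≤ n) (p : Fin d → ℝ)
    (hp : ∀ ν, |p ν| ≤ Real.pi) (ν₀ : Fin d) (hν₀ : p ν₀ ≠ 0) (μ lam ν : Fin d)
    (x : Fin d → ℝ) :
    ‖kerFib n μ lam ν p x‖ ≤ C0maj d * Real.pi + C1maj d * aliasConst d 0 := by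
  have hW := sum_h163_weighted_le hd le_rfl zero_lt_one hn p hp ν₀ hν₀ μ lam ν
  rw [Real.rpow_zero, mul_one] at hW
  unfold kerFib
  calc ‖∑ k : Fin d → Fin n, coef n μ lam ν p k * phase (symmAlias n k p) x‖
      ≤ ∑ k : Fin d → Fin n, ‖coef n μ lam ν p k * phase (symmAlias n k p) x‖ := norm_sum_le _ _
    _ = ∑ k : Fin d → Fin n, ‖B5Hk163Strip.h163 n μ lam k (ofRealVec p)‖ * bwt n k p ν 0 := by
        refine Finset.sum_congr rfl fun k _ => ?_
        rw [norm_mul, norm_phase, mul_one, ← norm_coef_mul_rpow, Real.rpow_zero, mul_one]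
    _ ≤ _ := hW

/-- HÖLDER MODULUS of the fixed-fibre kernel, uniform in the level: for `0 ≤ α < 1`,
`|ker^{(n)}(x) − ker^{(n)}(x′)| ≤ 2^{1−α} |x − x′|₁^α (C₀ π^{1+α} + C₁ aliasConst_d(α))`
(phase modulus + the weighted alias sum of `B5Hk163Rate` §6). [folklore] -/
theorem kerFib_holder_le (hd : 0 < d) {α : ℝ} (hα0 : 0 ≤ α) (hα : α < 1) {n : ℕ} [NeZero n]
    (hn : 1 ≤ n) (p : Fin d → ℝ) (hp : ∀ ν, |p ν| ≤ Real.pi) (ν₀ : Fin d) (hν₀ : p ν₀ ≠ 0)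
    (μ lam ν : Fin d) (x x' : Fin d → ℝ) :
    ‖kerFib n μ lam ν p x - kerFib n μ lam ν p x'‖
      ≤ 2 ^ (1 - α) * l1 (x - x') ^ α
          * (C0maj d * (Real.pi * Real.pi ^ α) + C1maj d * aliasConst d α) := by
  have hW := sum_h163_weighted_le hd hα0 hα hn p hp ν₀ hν₀ μ lam ν
  have h2 : 0 ≤ (2 : ℝ) ^ (1 - α) * l1 (x - x') ^ α :=
    mul_nonneg (Real.rpow_nonneg (by norm_num) _) (Real.rpow_nonneg (l1_nonneg _) _)
  unfold kerFib
  rw [← Finset.sum_sub_distrib]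
  calc ‖∑ k : Fin d → Fin n, (coef n μ lam ν p k * phase (symmAlias n k p) x
          - coef n μ lam ν p k * phase (symmAlias n k p) x')‖
      ≤ ∑ k : Fin d → Fin n, ‖coef n μ lam ν p k * phase (symmAlias n k p) x
          - coef n μ lam ν p k * phase (symmAlias n k p) x'‖ := norm_sum_le _ _
    _ ≤ ∑ k : Fin d → Fin n, 2 ^ (1 - α) * l1 (x - x') ^ α
          * (‖B5Hk163Strip.h163 n μ lam k (ofRealVec p)‖ * bwt n k p ν α) := by
        refine Finset.sum_le_sum fun k _ => ?_
        rw [← mul_sub, norm_mul, ← norm_coef_mul_rpow]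
        calc ‖coef n μ lam ν p k‖ * ‖phase (symmAlias n k p) x - phase (symmAlias n k p) x'‖
            ≤ ‖coef n μ lam ν p k‖
                * (2 ^ (1 - α) * (‖symmAlias n k p‖ ^ α * l1 (x - x') ^ α)) :=
              mul_le_mul_of_nonneg_left (norm_phase_sub_phase_le hα0 hα.le _ _ _) (norm_nonneg _)
          _ = 2 ^ (1 - α) * l1 (x - x') ^ α * (‖coef n μ lam ν p k‖ * ‖symmAlias n k p‖ ^ α) := by
              ring
    _ = 2 ^ (1 - α) * l1 (x - x') ^ α
          * ∑ k : Fin d → Fin n, ‖B5Hk163Strip.h163 n μ lam k (ofRealVec p)‖ * bwt n k p ν α := by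
        rw [Finset.mul_sum]
    _ ≤ _ := mul_le_mul_of_nonneg_left hW h2

/-! ## 4. The kernel at the finer level `RN`, re-indexed by the pairing `ι` -/

/-- the level-`RN` kernel split into the terms paired with level `N` (re-indexed by `ι`, whose
frequency `q̃_{ιk} = q̃_k` is the SAME plane wave) and the unpaired remainder. [folklore] -/
theorem kerFib_fine_eq {N R : ℕ} [NeZero N] [NeZero R] (hN : 1 ≤ N) {p : Fin d → ℝ}
    (hp : ∀ ν, |p ν| ≤ Real.pi) (μ lam ν : Fin d) (x : Fin d → ℝ) :
    kerFib (R * N) μ lam ν p x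
      = ∑ k : Fin d → Fin N, coef (R * N) μ lam ν p (iota R k p) * phase (symmAlias N k p) x
        + ∑ k'' ∈ Finset.univ.filter (fun k'' => ∀ k : Fin d → Fin N, iota R k p ≠ k''),
            coef (R * N) μ lam ν p k'' * phase (symmAlias (R * N) k'' p) x := by
  unfold kerFib
  rw [sum_split_iota hN hp
    (fun k'' => coef (R * N) μ lam ν p k'' * phase (symmAlias (R * N) k'' p) x)]
  congr 1
  exact Finset.sum_congr rfl fun k _ => by rw [symmAlias_iota hN k hp]

/-- THE KERNEL DIFFERENCE between the levels `RN` and `N` at a fixed fibre: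
`Σ_k (c^{(RN)}_{ιk} − c^{(N)}_k) e^{i q̃_k·x} + Σ_{k″ unpaired} c^{(RN)}_{k″} e^{i q̃_{k″}·x}`.
[folklore] -/
theorem kerFib_sub_eq {N R : ℕ} [NeZero N] [NeZero R] (hN : 1 ≤ N) {p : Fin d → ℝ}
    (hp : ∀ ν, |p ν| ≤ Real.pi) (μ lam ν : Fin d) (x : Fin d → ℝ) :
    kerFib (R * N) μ lam ν p x - kerFib N μ lam ν p x
      = ∑ k : Fin d → Fin N, (coef (R * N) μ lam ν p (iota R k p) - coef N μ lam ν p k)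
            * phase (symmAlias N k p) x
        + ∑ k'' ∈ Finset.univ.filter (fun k'' => ∀ k : Fin d → Fin N, iota R k p ≠ k''),
            coef (R * N) μ lam ν p k'' * phase (symmAlias (R * N) k'' p) x := by
  rw [kerFib_fine_eq hN hp μ lam ν x]
  unfold kerFib
  simp only [sub_mul, Finset.sum_sub_distrib]
  ring

/-! ## 5. The η-rate in position space: sup norm and Hölder modulus (King (4.19)/(4.26) shape) -/

/-- SUP-NORM RATE of the fixed-fibre kernel (the `m = 0` + `m ≠ 0` bookkeeping of King p.672 in
position space): for `0 < γ < 1`, uniformly in `x ∈ ℝ^d`, the fibre `p′ ≠ 0` and `R`,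
`|ker^{(RN)}(x) − ker^{(N)}(x)| ≤ T163(d,0,γ) · N^{−γ}`. [folklore] -/
theorem kerFib_rate (hd : 0 < d) {γ : ℝ} (hγ0 : 0 < γ) (hγ1 : γ < 1) {N R : ℕ} [NeZero N]
    [NeZero R] (hN : 1 ≤ N) (hR : 1 ≤ R) (p : Fin d → ℝ) (hp : ∀ ν, |p ν| ≤ Real.pi)
    (ν₀ : Fin d) (hν₀ : p ν₀ ≠ 0) (μ lam ν : Fin d) (x : Fin d → ℝ) :
    ‖kerFib (R * N) μ lam ν p x - kerFib N μ lam ν p x‖ ≤ T163 d 0 γ / (N : ℝ) ^ γ := by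
  have hT := weighted_alias_sum_rate hd le_rfl hγ0 hγ1.le (by simpa using hγ1) hN hR p hp ν₀ hν₀
    μ lam ν
  simp only [Real.rpow_zero, mul_one] at hT
  rw [kerFib_sub_eq hN hp μ lam ν x]
  calc ‖(∑ k : Fin d → Fin N, (coef (R * N) μ lam ν p (iota R k p) - coef N μ lam ν p k)
            * phase (symmAlias N k p) x)
        + ∑ k'' ∈ Finset.univ.filter (fun k'' => ∀ k : Fin d → Fin N, iota R k p ≠ k''),
            coef (R * N) μ lam ν p k'' * phase (symmAlias (R * N) k'' p) x‖
      ≤ ‖∑ k : Fin d → Fin N, (coef (R * N) μ lam ν p (iota R k p) - coef N μ lam ν p k)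
            * phase (symmAlias N k p) x‖
        + ‖∑ k'' ∈ Finset.univ.filter (fun k'' => ∀ k : Fin d → Fin N, iota R k p ≠ k''),
            coef (R * N) μ lam ν p k'' * phase (symmAlias (R * N) k'' p) x‖ := norm_add_le _ _
    _ ≤ (∑ k : Fin d → Fin N, ‖coef (R * N) μ lam ν p (iota R k p) - coef N μ lam ν p k‖)
        + ∑ k'' ∈ Finset.univ.filter (fun k'' => ∀ k : Fin d → Fin N, iota R k p ≠ k''),
            ‖coef (R * N) μ lam ν p k''‖ := by
        gcongr
        · exact (norm_sum_le _ _).trans (le_of_eq (Finset.sum_congr rfl fun k _ => by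
            rw [norm_mul, norm_phase, mul_one]))
        · exact (norm_sum_le _ _).trans (le_of_eq (Finset.sum_congr rfl fun k _ => by
            rw [norm_mul, norm_phase, mul_one]))
    _ ≤ _ := by simpa [coef] using hT

/-- HÖLDER-MODULUS RATE of the fixed-fibre kernel (King (4.24)/(4.26) p.673 combined with the
weighted alias-sum rate): for `0 ≤ α`, `0 < γ ≤ 1`, `α + γ < 1`, uniformly in `x, x′ ∈ ℝ^d`,
`p′ ≠ 0` and `R`:
`|[ker^{(RN)} − ker^{(N)}](x) − [ker^{(RN)} − ker^{(N)}](x′)| ≤ 2^{1−α}|x−x′|₁^α T163(d,α,γ) N^{−γ}`.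
[folklore] -/
theorem kerFib_rate_holder (hd : 0 < d) {α γ : ℝ} (hα0 : 0 ≤ α) (hγ0 : 0 < γ) (hγ1 : γ ≤ 1)
    (hαγ : α + γ < 1) {N R : ℕ} [NeZero N] [NeZero R] (hN : 1 ≤ N) (hR : 1 ≤ R)
    (p : Fin d → ℝ) (hp : ∀ ν, |p ν| ≤ Real.pi) (ν₀ : Fin d) (hν₀ : p ν₀ ≠ 0) (μ lam ν : Fin d)
    (x x' : Fin d → ℝ) :
    ‖(kerFib (R * N) μ lam ν p x - kerFib N μ lam ν p x)
        - (kerFib (R * N) μ lam ν p x' - kerFib N μ lam ν p x')‖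
      ≤ 2 ^ (1 - α) * l1 (x - x') ^ α * (T163 d α γ / (N : ℝ) ^ γ) := by
  have hT := weighted_alias_sum_rate hd hα0 hγ0 hγ1 hαγ hN hR p hp ν₀ hν₀ μ lam ν
  have hα1 : α ≤ 1 := by linarith
  have h2 : 0 ≤ (2 : ℝ) ^ (1 - α) * l1 (x - x') ^ α :=
    mul_nonneg (Real.rpow_nonneg (by norm_num) _) (Real.rpow_nonneg (l1_nonneg _) _)
  rw [kerFib_sub_eq hN hp μ lam ν x, kerFib_sub_eq hN hp μ lam ν x']
  have hre :
      (∑ k : Fin d → Fin N, (coef (R * N) μ lam ν p (iota R k p) - coef N μ lam ν p k)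
            * phase (symmAlias N k p) x
        + ∑ k'' ∈ Finset.univ.filter (fun k'' => ∀ k : Fin d → Fin N, iota R k p ≠ k''),
            coef (R * N) μ lam ν p k'' * phase (symmAlias (R * N) k'' p) x)
      - (∑ k : Fin d → Fin N, (coef (R * N) μ lam ν p (iota R k p) - coef N μ lam ν p k)
            * phase (symmAlias N k p) x'
        + ∑ k'' ∈ Finset.univ.filter (fun k'' => ∀ k : Fin d → Fin N, iota R k p ≠ k''),
            coef (R * N) μ lam ν p k'' * phase (symmAlias (R * N) k'' p) x')
      = ∑ k : Fin d → Fin N, (coef (R * N) μ lam ν p (iota R k p) - coef N μ lam ν p k)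
            * (phase (symmAlias N k p) x - phase (symmAlias N k p) x')
        + ∑ k'' ∈ Finset.univ.filter (fun k'' => ∀ k : Fin d → Fin N, iota R k p ≠ k''),
            coef (R * N) μ lam ν p k''
              * (phase (symmAlias (R * N) k'' p) x - phase (symmAlias (R * N) k'' p) x') := by
    simp only [mul_sub, Finset.sum_sub_distrib]
    ring
  rw [hre]
  calc ‖(∑ k : Fin d → Fin N, (coef (R * N) μ lam ν p (iota R k p) - coef N μ lam ν p k)
            * (phase (symmAlias N k p) x - phase (symmAlias N k p) x'))
        + ∑ k'' ∈ Finset.univ.filter (fun k'' => ∀ k : Fin d → Fin N, iota R k p ≠ k''),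
            coef (R * N) μ lam ν p k''
              * (phase (symmAlias (R * N) k'' p) x - phase (symmAlias (R * N) k'' p) x')‖
      ≤ ‖∑ k : Fin d → Fin N, (coef (R * N) μ lam ν p (iota R k p) - coef N μ lam ν p k)
            * (phase (symmAlias N k p) x - phase (symmAlias N k p) x')‖
        + ‖∑ k'' ∈ Finset.univ.filter (fun k'' => ∀ k : Fin d → Fin N, iota R k p ≠ k''),
            coef (R * N) μ lam ν p k''
              * (phase (symmAlias (R * N) k'' p) x - phase (symmAlias (R * N) k'' p) x')‖ :=
        norm_add_le _ _
    _ ≤ (∑ k : Fin d → Fin N, 2 ^ (1 - α) * l1 (x - x') ^ α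
            * (‖coef (R * N) μ lam ν p (iota R k p) - coef N μ lam ν p k‖
                * ‖symmAlias N k p‖ ^ α))
        + ∑ k'' ∈ Finset.univ.filter (fun k'' => ∀ k : Fin d → Fin N, iota R k p ≠ k''),
            2 ^ (1 - α) * l1 (x - x') ^ α
              * (‖coef (R * N) μ lam ν p k''‖ * ‖symmAlias (R * N) k'' p‖ ^ α) := by
        gcongr with k _ k'' _
        · refine (norm_sum_le _ _).trans (Finset.sum_le_sum fun k _ => ?_)
          rw [norm_mul]
          calc ‖coef (R * N) μ lam ν p (iota R k p) - coef N μ lam ν p k‖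
                * ‖phase (symmAlias N k p) x - phase (symmAlias N k p) x'‖
              ≤ ‖coef (R * N) μ lam ν p (iota R k p) - coef N μ lam ν p k‖
                * (2 ^ (1 - α) * (‖symmAlias N k p‖ ^ α * l1 (x - x') ^ α)) :=
                mul_le_mul_of_nonneg_left (norm_phase_sub_phase_le hα0 hα1 _ _ _) (norm_nonneg _)
            _ = _ := by ring
        · refine (norm_sum_le _ _).trans (Finset.sum_le_sum fun k'' _ => ?_)
          rw [norm_mul]
          calc ‖coef (R * N) μ lam ν p k''‖
                * ‖phase (symmAlias (R * N) k'' p) x - phase (symmAlias (R * N) k'' p) x'‖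
              ≤ ‖coef (R * N) μ lam ν p k''‖
                * (2 ^ (1 - α) * (‖symmAlias (R * N) k'' p‖ ^ α * l1 (x - x') ^ α)) :=
                mul_le_mul_of_nonneg_left (norm_phase_sub_phase_le hα0 hα1 _ _ _) (norm_nonneg _)
            _ = _ := by ring
    _ = 2 ^ (1 - α) * l1 (x - x') ^ α
        * ((∑ k : Fin d → Fin N, ‖coef (R * N) μ lam ν p (iota R k p) - coef N μ lam ν p k‖
              * ‖symmAlias N k p‖ ^ α)
          + ∑ k'' ∈ Finset.univ.filter (fun k'' => ∀ k : Fin d → Fin N, iota R k p ≠ k''),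
              ‖coef (R * N) μ lam ν p k''‖ * ‖symmAlias (R * N) k'' p‖ ^ α) := by
        rw [mul_add, Finset.mul_sum, Finset.mul_sum]
    _ ≤ _ := mul_le_mul_of_nonneg_left (by simpa [coef] using hT) h2

/-- the same as a HÖLDER DIFFERENCE QUOTIENT (King's (4.26) reading `|x−y|^{−α}|…|`): for
`x ≠ x′` (i.e. `|x − x′|₁ > 0`),
`|Δker(x) − Δker(x′)| / |x − x′|₁^α ≤ 2^{1−α} T163(d,α,γ) N^{−γ}`. [folklore] -/
theorem kerFib_rate_holder_quotient (hd : 0 < d) {α γ : ℝ} (hα0 : 0 ≤ α) (hγ0 : 0 < γ)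
    (hγ1 : γ ≤ 1) (hαγ : α + γ < 1) {N R : ℕ} [NeZero N] [NeZero R] (hN : 1 ≤ N) (hR : 1 ≤ R)
    (p : Fin d → ℝ) (hp : ∀ ν, |p ν| ≤ Real.pi) (ν₀ : Fin d) (hν₀ : p ν₀ ≠ 0) (μ lam ν : Fin d)
    {x x' : Fin d → ℝ} (hxx' : 0 < l1 (x - x')) :
    ‖(kerFib (R * N) μ lam ν p x - kerFib N μ lam ν p x)
        - (kerFib (R * N) μ lam ν p x' - kerFib N μ lam ν p x')‖ / l1 (x - x') ^ α
      ≤ 2 ^ (1 - α) * (T163 d α γ / (N : ℝ) ^ γ) := by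
  have hl : 0 < l1 (x - x') ^ α := Real.rpow_pos_of_pos hxx' _
  rw [div_le_iff₀ hl]
  calc _ ≤ 2 ^ (1 - α) * l1 (x - x') ^ α * (T163 d α γ / (N : ℝ) ^ γ) :=
        kerFib_rate_holder hd hα0 hγ0 hγ1 hαγ hN hR p hp ν₀ hν₀ μ lam ν x x'
    _ = 2 ^ (1 - α) * (T163 d α γ / (N : ℝ) ^ γ) * l1 (x - x') ^ α := by ring

/-! ## 6. Summing over the fibres of a finite unit torus -/

/-- THE FIBRE SUM (the reader's unit-torus kernel is `M^{−d} Σ_{p′} e^{ip′·(x−y)} ker_{p′}(x)`;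
here any finite family `S` of non-zero fibres in the closed zone and any coefficients of modulus
`≤ 1`): `|Σ_{p′∈S} c_{p′} (ker^{(RN)}_{p′}(x) − ker^{(N)}_{p′}(x))| ≤ |S| · T163(d,0,γ) N^{−γ}`.
[folklore] -/
theorem kerFib_rate_fibreSum (hd : 0 < d) {γ : ℝ} (hγ0 : 0 < γ) (hγ1 : γ < 1) {N R : ℕ}
    [NeZero N] [NeZero R] (hN : 1 ≤ N) (hR : 1 ≤ R) (μ lam ν : Fin d)
    (S : Finset (Fin d → ℝ)) (hS : ∀ p ∈ S, (∀ ν', |p ν'| ≤ Real.pi) ∧ ∃ ν₀, p ν₀ ≠ 0)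
    (c : (Fin d → ℝ) → ℂ) (hc : ∀ p ∈ S, ‖c p‖ ≤ 1) (x : Fin d → ℝ) :
    ‖∑ p ∈ S, c p * (kerFib (R * N) μ lam ν p x - kerFib N μ lam ν p x)‖
      ≤ S.card * (T163 d 0 γ / (N : ℝ) ^ γ) := by
  calc ‖∑ p ∈ S, c p * (kerFib (R * N) μ lam ν p x - kerFib N μ lam ν p x)‖
      ≤ ∑ p ∈ S, ‖c p * (kerFib (R * N) μ lam ν p x - kerFib N μ lam ν p x)‖ := norm_sum_le _ _
    _ ≤ ∑ p ∈ S, T163 d 0 γ / (N : ℝ) ^ γ := by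
        refine Finset.sum_le_sum fun p hpS => ?_
        obtain ⟨hz, ν₀, hν₀⟩ := hS p hpS
        rw [norm_mul]
        calc ‖c p‖ * ‖kerFib (R * N) μ lam ν p x - kerFib N μ lam ν p x‖
            ≤ 1 * (T163 d 0 γ / (N : ℝ) ^ γ) :=
              mul_le_mul (hc p hpS) (kerFib_rate hd hγ0 hγ1 hN hR p hz ν₀ hν₀ μ lam ν x)
                (norm_nonneg _) zero_le_one
          _ = _ := one_mul _
    _ = S.card * (T163 d 0 γ / (N : ℝ) ^ γ) := by rw [Finset.sum_const, nsmul_eq_mul]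

/-- the fibre sum of the HÖLDER MODULUS: under the same hypotheses and `0 ≤ α`, `α + γ < 1`,
`|Σ_{p′∈S} c_{p′} ([Δker_{p′}](x) − [Δker_{p′}](x′))| ≤ |S| · 2^{1−α}|x−x′|₁^α T163(d,α,γ) N^{−γ}`.
[folklore] -/
theorem kerFib_rate_holder_fibreSum (hd : 0 < d) {α γ : ℝ} (hα0 : 0 ≤ α) (hγ0 : 0 < γ)
    (hγ1 : γ ≤ 1) (hαγ : α + γ < 1) {N R : ℕ} [NeZero N] [NeZero R] (hN : 1 ≤ N) (hR : 1 ≤ R)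
    (μ lam ν : Fin d) (S : Finset (Fin d → ℝ))
    (hS : ∀ p ∈ S, (∀ ν', |p ν'| ≤ Real.pi) ∧ ∃ ν₀, p ν₀ ≠ 0)
    (c : (Fin d → ℝ) → ℂ) (hc : ∀ p ∈ S, ‖c p‖ ≤ 1) (x x' : Fin d → ℝ) :
    ‖∑ p ∈ S, c p * ((kerFib (R * N) μ lam ν p x - kerFib N μ lam ν p x)
        - (kerFib (R * N) μ lam ν p x' - kerFib N μ lam ν p x'))‖
      ≤ S.card * (2 ^ (1 - α) * l1 (x - x') ^ α * (T163 d α γ / (N : ℝ) ^ γ)) := by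
  calc ‖∑ p ∈ S, c p * ((kerFib (R * N) μ lam ν p x - kerFib N μ lam ν p x)
          - (kerFib (R * N) μ lam ν p x' - kerFib N μ lam ν p x'))‖
      ≤ ∑ p ∈ S, ‖c p * ((kerFib (R * N) μ lam ν p x - kerFib N μ lam ν p x)
          - (kerFib (R * N) μ lam ν p x' - kerFib N μ lam ν p x'))‖ := norm_sum_le _ _
    _ ≤ ∑ p ∈ S, 2 ^ (1 - α) * l1 (x - x') ^ α * (T163 d α γ / (N : ℝ) ^ γ) := by
        refine Finset.sum_le_sum fun p hpS => ?_
        obtain ⟨hz, ν₀, hν₀⟩ := hS p hpS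
        rw [norm_mul]
        calc ‖c p‖ * ‖(kerFib (R * N) μ lam ν p x - kerFib N μ lam ν p x)
                - (kerFib (R * N) μ lam ν p x' - kerFib N μ lam ν p x')‖
            ≤ 1 * (2 ^ (1 - α) * l1 (x - x') ^ α * (T163 d α γ / (N : ℝ) ^ γ)) :=
              mul_le_mul (hc p hpS)
                (kerFib_rate_holder hd hα0 hγ0 hγ1 hαγ hN hR p hz ν₀ hν₀ μ lam ν x x')
                (norm_nonneg _) zero_le_one
          _ = _ := one_mul _
    _ = S.card * (2 ^ (1 - α) * l1 (x - x') ^ α * (T163 d α γ / (N : ℝ) ^ γ)) := by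
        rw [Finset.sum_const, nsmul_eq_mul]

end

end Literature.MathematicalPhysics.QuantumFieldTheory.Balaban1983to89.B5Hk163RatePosition
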